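import Literature.LinearAlgebra.Matrix.RealBilinearSwapTensorInvariance      -- ★ A-p14 p843516: swap ∕ twin tensor invariance for real-bilinear forms
import Literature.Geometry.ComplexHyperbolic.UnitBallU21                         -- ★ `J = diag(1,1,−1)`
import HarnessLib

/-!
# (β1, abstract) `Ad(K)`-transport of the transversal datum FORM: the five-term `(J_kk J_ll).re`-weighted combination of ★ `UnitBallKCentralTransversalDatum` is invariant under
# `(q₂, q₁, P) ↦ (q₂∘(Ad M)², q₁∘Ad M, M′PM)` for `MM′ = 1`, `MᴴJM = J` (Rogawski 1990 §8.4; Hall GTM 222 Prop. 3.24) — ROAD A owner R-14.9 (ii): «state it FIRST for an abstract real-bilinear q»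

Topic `Geometry/ComplexHyperbolic`; namespace `Literature.Geometry.ComplexHyperbolic.BallModel.TransversalForm`.  THEOREMS ONLY (no `def`, no instance, no notation, no axiom, no named fact,
no `sorry`).  Cell `pub/hodgecm-mathlib`, ENGINE T1 (crux H413 = `stmt-HodgeConjecture-24833`); ROAD A, (A4-iii) «THE VALUE», brick (β) «POINTWISE χ-JET IDENTITY at `W = s•ω`», part (β1)
abstract (census `F0/P3a/A-p18/g26/CENSUS-beta-ChiJetRepresentativePoint.A-p18g26.md`).  Author A-p18 (g26), 2026-09-01.

WHAT IS PROVED.  For every real-bilinear `q₂ : M₃(ℂ) × M₃(ℂ) → E`, real-linear `q₁`, `u : ℂ`, `c : ℝ`, `P : M₃(ℂ)` and `M, M′` with `MM′ = 1`, `MᴴJM = J`: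
`Φ[q₂∘(Ad M)², q₁∘(Ad M), M′PM] = Φ[q₂, q₁, P]` (`datumForm_conj_eq`), where `Φ[q₂,q₁,P]` is A-p14's datum combination
`(1∕3)•[Σ_{k,l}((J_kk J_ll).re•(q₂(u•E_klP, u•PE_kl) + q₂(u•iE_klP, u•iPE_kl)) − q₂(u•E_klP, u•E_lkP) + q₂(u•iE_klP, u•iE_lkP)) − q₂(u•iP, u•iP)] − c•q₁(u•P)` and `(Ad M)X = MXM′`.
PROOF: `M(E_kl·M′PM)M′ = (ME_klM′)·P` etc.; the `(J_kk J_ll).re`-weighted pair is ★ A-p14 `sum_sum_smul_conj_single_same_eq` (`e = (1,1,−1)`, `(J_kk J_ll).re = re(e_l∕e_k)`) for the real-bilinear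
`(A,B) ↦ q₂(u•AP, u•PB)`; the unweighted pair is ★ `sum_sum_conj_single_swap_eq` for `(A,B) ↦ q₂(u•AP, u•BP)`; the last two terms are invariant on the nose.
USE (β1 concrete, next): for `K`-invariant `Θ` and `κ = diag(U,1)`, `D²Θ(κhκᴴ)[A,B] = D²Θ(h)[κᴴAκ, κᴴBκ]`, so the χ-datum at `W = U·(s,0)` is `Φ[q₂∘(Ad κᴴ)², …, κ N κᴴ]` = `Φ[q₂, q₁, N]` at `(s,0)`.
HONEST LABEL: finite-dimensional linear algebra over ★ A-p14; pays nothing by itself (HC_CM is proved only modulo the printed citations until rung 0 closes).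

## References
* [Rogawski1990] J. D. Rogawski, *Automorphic Representations of Unitary Groups in Three Variables*, Ann. of Math. Stud. 123 (1990), §8.4 pp. 126–127.
* [Hall2015] B. C. Hall, *Lie Groups, Lie Algebras, and Representations*, 2nd ed., GTM 222 (2015), Prop. 3.24.
-/

set_option autoImplicit false

noncomputable section

open Matrix Complex
open scoped ComplexConjugate

namespace Literature.Geometry.ComplexHyperbolic.BallModel.TransversalForm

variable {E : Type*} [AddCommGroup E] [Module ℝ E]

/-- The datum's weights are A-p14's twin weights for `e = (1, 1, −1)`: `(J_kk J_ll).re = re(e_l ∕ e_k)`. [cite: Hall2015, Prop. 3.24] -/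
theorem J_mul_J_re_eq (k l : Fin 3) : (J k k * J l l).re = ((![(1 : ℂ), 1, -1] : Fin 3 → ℂ) l / (![(1 : ℂ), 1, -1] : Fin 3 → ℂ) k).re := by
  fin_cases k <;> fin_cases l <;> simp [J]

/-- `J = diag(1,1,−1)` as `Matrix.diagonal` of the weight vector. [cite: Hall2015, Prop. 3.24] -/
theorem J_eq_diagonal : J = Matrix.diagonal (![(1 : ℂ), 1, -1] : Fin 3 → ℂ) := rfl

/-- **(β1, abstract) `Ad`-TRANSPORT OF THE TRANSVERSAL DATUM FORM.**  See the module docstring. [cite: Rogawski1990, §8.4 pp. 126–127] [cite: Hall2015, Prop. 3.24] -/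
theorem datumForm_conj_eq (q₂ : Matrix (Fin 3) (Fin 3) ℂ →ₗ[ℝ] Matrix (Fin 3) (Fin 3) ℂ →ₗ[ℝ] E) (q₁ : Matrix (Fin 3) (Fin 3) ℂ →ₗ[ℝ] E) (u : ℂ) (c : ℝ) (P M M' : Matrix (Fin 3) (Fin 3) ℂ)
    (hMM' : M * M' = 1) (hMJ : Mᴴ * J * M = J) :
    (1 / 3 : ℝ) • ((∑ k : Fin 3, ∑ l : Fin 3, ((J k k * J l l).re • (q₂ (M * (u • (Matrix.single k l (1 : ℂ) * (M' * P * M))) * M') (M * (u • ((M' * P * M) * Matrix.single k l (1 : ℂ))) * M') +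
            q₂ (M * (u • (I • (Matrix.single k l (1 : ℂ) * (M' * P * M)))) * M') (M * (u • (I • ((M' * P * M) * Matrix.single k l (1 : ℂ)))) * M')) -
          q₂ (M * (u • (Matrix.single k l (1 : ℂ) * (M' * P * M))) * M') (M * (u • (Matrix.single l k (1 : ℂ) * (M' * P * M))) * M') +
          q₂ (M * (u • (I • (Matrix.single k l (1 : ℂ) * (M' * P * M)))) * M') (M * (u • (I • (Matrix.single l k (1 : ℂ) * (M' * P * M)))) * M'))) -
        q₂ (M * (u • (I • (M' * P * M))) * M') (M * (u • (I • (M' * P * M))) * M')) -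
      c • q₁ (M * (u • (M' * P * M)) * M') =
    (1 / 3 : ℝ) • ((∑ k : Fin 3, ∑ l : Fin 3, ((J k k * J l l).re • (q₂ (u • (Matrix.single k l (1 : ℂ) * P)) (u • (P * Matrix.single k l (1 : ℂ))) +
            q₂ (u • (I • (Matrix.single k l (1 : ℂ) * P))) (u • (I • (P * Matrix.single k l (1 : ℂ))))) -
          q₂ (u • (Matrix.single k l (1 : ℂ) * P)) (u • (Matrix.single l k (1 : ℂ) * P)) +
          q₂ (u • (I • (Matrix.single k l (1 : ℂ) * P))) (u • (I • (Matrix.single l k (1 : ℂ) * P))))) -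
        q₂ (u • (I • P)) (u • (I • P))) -
      c • q₁ (u • P) := by
  -- conjugation through the slots
  have hl : ∀ X : Matrix (Fin 3) (Fin 3) ℂ, M * (X * (M' * P * M)) * M' = M * X * M' * P := fun X => by
    simp only [Matrix.mul_assoc, hMM', Matrix.mul_one]
  have hr : ∀ X : Matrix (Fin 3) (Fin 3) ℂ, M * (M' * P * M * X) * M' = P * (M * X * M') := fun X => by
    rw [← Matrix.mul_assoc, ← Matrix.mul_assoc, ← Matrix.mul_assoc, hMM', Matrix.one_mul, Matrix.mul_assoc, Matrix.mul_assoc, Matrix.mul_assoc]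
  have hP : M * (M' * P * M) * M' = P := by
    rw [← Matrix.mul_assoc, ← Matrix.mul_assoc, hMM', Matrix.one_mul, Matrix.mul_assoc, hMM', Matrix.mul_one]
  -- the two real-bilinear forms fed to ★ A-p14
  obtain ⟨Q, hQ⟩ : ∃ Q : Matrix (Fin 3) (Fin 3) ℂ →ₗ[ℝ] Matrix (Fin 3) (Fin 3) ℂ →ₗ[ℝ] E, ∀ A B, Q A B = q₂ (u • (A * P)) (u • (P * B)) :=
    ⟨LinearMap.mk₂ ℝ (fun A B => q₂ (u • (A * P)) (u • (P * B)))
      (fun A₁ A₂ B => by simp only [Matrix.add_mul, smul_add, map_add, LinearMap.add_apply])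
      (fun r A B => by rw [Matrix.smul_mul, smul_comm u r (A * P), LinearMap.map_smul, LinearMap.smul_apply])
      (fun A B₁ B₂ => by simp only [Matrix.mul_add, smul_add, map_add])
      (fun r A B => by rw [Matrix.mul_smul, smul_comm u r (P * B), LinearMap.map_smul]), fun A B => rfl⟩
  obtain ⟨Q', hQ'⟩ : ∃ Q' : Matrix (Fin 3) (Fin 3) ℂ →ₗ[ℝ] Matrix (Fin 3) (Fin 3) ℂ →ₗ[ℝ] E, ∀ A B, Q' A B = q₂ (u • (A * P)) (u • (B * P)) :=
    ⟨LinearMap.mk₂ ℝ (fun A B => q₂ (u • (A * P)) (u • (B * P)))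
      (fun A₁ A₂ B => by simp only [Matrix.add_mul, smul_add, map_add, LinearMap.add_apply])
      (fun r A B => by rw [Matrix.smul_mul, smul_comm u r (A * P), LinearMap.map_smul, LinearMap.smul_apply])
      (fun A B₁ B₂ => by simp only [Matrix.add_mul, smul_add, map_add])
      (fun r A B => by rw [Matrix.smul_mul, smul_comm u r (B * P), LinearMap.map_smul]), fun A B => rfl⟩
  have he : ∀ k : Fin 3, (![(1 : ℂ), 1, -1] : Fin 3 → ℂ) k ≠ 0 := by intro k; fin_cases k <;> simp
  have hereal : ∀ k : Fin 3, conj ((![(1 : ℂ), 1, -1] : Fin 3 → ℂ) k) = (![(1 : ℂ), 1, -1] : Fin 3 → ℂ) k := by intro k; fin_cases k <;> simp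
  have hMH : Mᴴ * Matrix.diagonal (![(1 : ℂ), 1, -1] : Fin 3 → ℂ) * M = Matrix.diagonal (![(1 : ℂ), 1, -1] : Fin 3 → ℂ) := by rw [← J_eq_diagonal]; exact hMJ
  have h1 := _root_.Literature.LinearAlgebra.Matrix.sum_sum_smul_conj_single_same_eq Q he hereal hMH hMM'
  have h2 := _root_.Literature.LinearAlgebra.Matrix.sum_sum_conj_single_swap_eq Q' hMM'
  -- rewrite everything in terms of `Q`, `Q'`
  simp only [hl, hr, hP, J_mul_J_re_eq, Matrix.smul_mul, Matrix.mul_smul, Finset.sum_add_distrib, Finset.sum_sub_distrib]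
  simp only [hQ, hQ', Matrix.smul_mul, Matrix.mul_smul, Finset.sum_sub_distrib] at h1 h2
  rw [h1]
  linear_combination (norm := module) (-(1 / 3 : ℝ)) • h2

end Literature.Geometry.ComplexHyperbolic.BallModel.TransversalForm

end
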